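import Mathlib
import Literature.Probability.PointProcesses.LensConsistentLaw
import Literature.MathematicalPhysics.StatisticalMechanics.LennardJonesClusters
import HarnessLib

/-!
# Crux `PatternPricedCertificates` (stmt-AtomisticToContinuum-12974), line `registered`: stub `stub_cubeTransport`

The cube transport identity, pointwise in the offset: out minus in of the rule "`v` receives `χ(v)/N` from
every point of its own cube of `sℤ³ + u`" equals the cube average of `χ` minus `χ` at the root. Helper for
`stub_unpricedMeanBound` (shift-averaged cube transport).

**Proof (finite-sum bookkeeping).** Two points in the same cube of side `s` are at distance
`< 2s` (`cubeTransport_norm_sub_lt`), so every point of `S` in the root's cube lies in the lens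
range (`< 2s ≤ L − r`, `cubeTransport_filter_lens`) and in the `r`-ball
(`cubeTransport_filter_insert_ball`), and, for a cube point `v`, the cube count computed in the
frame of `v` (pattern `reroot S v`, offset `u − v`) is the translate by `−v` of the root's cube
count (`cubeTransport_card_reroot`). Rewriting both transports with the rule, the out-sum is
`(1/N) Σ_{v ∈ cube ∖ {0}} χ(v)` and the in-sum is `χ(root) · (N − 1)/N`, `N` the number of
configuration points (root included) in the root's cube; `reroot S 0 = S`
(`cubeTransport_reroot_zero`) supplies the missing `w = 0` term. No new definitions; nothing is
assumed. [folklore]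
-/

noncomputable section

open scoped BigOperators Classical
open MeasureTheory

namespace Summit.AtomisticToContinuum.Crystallization.Theorems.PatternPricedCertificates

open Literature.Probability.PointProcesses (ballPattern lens reroot IsRootedPattern)

/-- Two points of `ℝ³` in the same half-open cube of side `s` of the grid `sℤ³ + u` (equal integer
parts of `(· i − u i) / s` for the three coordinates) are at distance `< 2s`. [folklore] -/
theorem cubeTransport_norm_sub_lt {s : ℝ} (hs : 0 < s) (u : Fin 3 → ℝ)
    {a b : EuclideanSpace ℝ (Fin 3)} (h : ∀ i : Fin 3, ⌊(a i - u i) / s⌋ = ⌊(b i - u i) / s⌋) :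
    ‖a - b‖ < 2 * s := by
  have hcoord : ∀ i, dist (a i) (b i) ≤ s := by
    intro i
    have h1 := Int.abs_sub_lt_one_of_floor_eq_floor (h i)
    rw [← sub_div, abs_div, abs_of_pos hs, div_lt_one hs,
      show a i - u i - (b i - u i) = a i - b i by ring] at h1
    rw [Real.dist_eq]
    exact h1.le
  have hsq : dist a b ^ 2 < (2 * s) ^ 2 := by
    rw [EuclideanSpace.dist_sq_eq]
    calc ∑ i, dist (a i) (b i) ^ 2 ≤ ∑ _i : Fin 3, s ^ 2 :=
          Finset.sum_le_sum fun i _ => pow_le_pow_left₀ dist_nonneg (hcoord i) 2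
      _ = 3 * s ^ 2 := by simp
      _ < (2 * s) ^ 2 := by nlinarith
  rw [← dist_eq_norm]
  exact lt_of_pow_lt_pow_left₀ 2 (by positivity) hsq

/-- A point in the root's cube of `sℤ³ + u` has norm `< 2s`. [folklore] -/
theorem cubeTransport_norm_lt {s : ℝ} (hs : 0 < s) (u : Fin 3 → ℝ)
    {a : EuclideanSpace ℝ (Fin 3)} (h : ∀ i : Fin 3, ⌊(a i - u i) / s⌋ = ⌊(0 - u i) / s⌋) :
    ‖a‖ < 2 * s := by
  have h' := cubeTransport_norm_sub_lt hs u (a := a) (b := 0) fun i => by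
    rw [h i, PiLp.zero_apply]
  rwa [sub_zero] at h'

/-- An admissible pattern with positive separation does not list the root. [folklore] -/
theorem cubeTransport_zero_notMem {δ L : ℝ} (hδ : 0 < δ) {S : Finset (EuclideanSpace ℝ (Fin 3))}
    (hS : IsRootedPattern δ L S) : (0 : EuclideanSpace ℝ (Fin 3)) ∉ S := fun h => by
  have h1 := (hS.1 0 h).1
  rw [norm_zero] at h1
  exact absurd h1 (not_le.2 hδ)

/-- Re-rooting at the root itself does nothing (when the root is not listed). [folklore] -/
theorem cubeTransport_reroot_zero {S : Finset (EuclideanSpace ℝ (Fin 3))}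
    (h0 : (0 : EuclideanSpace ℝ (Fin 3)) ∉ S) : reroot S 0 = S := by
  unfold reroot
  simp only [sub_zero, Finset.image_id']
  exact Finset.erase_insert h0

/-- Root side: the points of `insert 0 (B_r S)` in the root's cube are `0` and the points of `S` in
the root's cube (same cube ⇒ norm `< 2s ≤ r`). [folklore] -/
theorem cubeTransport_filter_insert_ball {s r : ℝ} (hs : 0 < s) (hsr : 2 * s ≤ r)
    (u : Fin 3 → ℝ) (S : Finset (EuclideanSpace ℝ (Fin 3))) :
    (insert (0 : EuclideanSpace ℝ (Fin 3)) (ballPattern r S)).filter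
        (fun w => ∀ i : Fin 3, ⌊(w i - u i) / s⌋ = ⌊(0 - u i) / s⌋) =
      insert 0 (S.filter fun w => ∀ i : Fin 3, ⌊(w i - u i) / s⌋ = ⌊(0 - u i) / s⌋) := by
  ext w
  simp only [Finset.mem_filter, Finset.mem_insert, ballPattern]
  constructor
  · rintro ⟨hw | hw, hP⟩
    · exact Or.inl hw
    · exact Or.inr ⟨hw.1, hP⟩
  · rintro (rfl | ⟨hw, hP⟩)
    · exact ⟨Or.inl rfl, fun i => by rw [PiLp.zero_apply]⟩
    · exact ⟨Or.inr ⟨hw, (cubeTransport_norm_lt hs u hP).le.trans hsr⟩, hP⟩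

/-- Lens side: the points of the lens range in the root's cube are the points of `S` in the root's
cube (norm `< 2s ≤ L − r`). [folklore] -/
theorem cubeTransport_filter_lens {s r L : ℝ} (hs : 0 < s) (hrL : r + 2 * s ≤ L) (u : Fin 3 → ℝ)
    (S : Finset (EuclideanSpace ℝ (Fin 3))) :
    (lens r L S).filter (fun w => ∀ i : Fin 3, ⌊(w i - u i) / s⌋ = ⌊(0 - u i) / s⌋) =
      S.filter fun w => ∀ i : Fin 3, ⌊(w i - u i) / s⌋ = ⌊(0 - u i) / s⌋ := by
  ext w
  simp only [Finset.mem_filter, lens]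
  constructor
  · rintro ⟨⟨hw, -⟩, hP⟩
    exact ⟨hw, hP⟩
  · rintro ⟨hw, hP⟩
    exact ⟨⟨hw, by linarith [cubeTransport_norm_lt hs u hP]⟩, hP⟩

/-- Neighbour side: for a point `v` of `S` in the root's cube, the points of
`insert 0 (B_r (reroot S v))` in the cube of the new root (for the offset `u − v` seen from `v`)
are the translates by `−v` of `0` and of the points of `S` in the root's cube; in particular both
endpoints count the same number of cube points. [folklore] -/
theorem cubeTransport_card_reroot {s r : ℝ} (hs : 0 < s) (hsr : 2 * s ≤ r) (u : Fin 3 → ℝ)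
    {S : Finset (EuclideanSpace ℝ (Fin 3))} (h0 : (0 : EuclideanSpace ℝ (Fin 3)) ∉ S)
    {v : EuclideanSpace ℝ (Fin 3)} (hv : v ∈ S)
    (hPv : ∀ i : Fin 3, ⌊(v i - u i) / s⌋ = ⌊(0 - u i) / s⌋) :
    ((insert (0 : EuclideanSpace ℝ (Fin 3)) (ballPattern r (reroot S v))).filter
        (fun w => ∀ i : Fin 3, ⌊(w i - (u i - v i)) / s⌋ = ⌊(0 - (u i - v i)) / s⌋)).card =
      (S.filter fun w => ∀ i : Fin 3, ⌊(w i - u i) / s⌋ = ⌊(0 - u i) / s⌋).card + 1 := by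
  have hshift : ∀ (z : EuclideanSpace ℝ (Fin 3)) (i : Fin 3), (z - v) i - (u i - v i) = z i - u i :=
    fun z i => by rw [PiLp.sub_apply]; ring
  have h0v : ∀ i : Fin 3, (0 : ℝ) - (u i - v i) = v i - u i := fun i => by ring
  have key : (insert (0 : EuclideanSpace ℝ (Fin 3)) (ballPattern r (reroot S v))).filter
      (fun w => ∀ i : Fin 3, ⌊(w i - (u i - v i)) / s⌋ = ⌊(0 - (u i - v i)) / s⌋) =
      (insert 0 (S.filter fun w => ∀ i : Fin 3, ⌊(w i - u i) / s⌋ = ⌊(0 - u i) / s⌋)).image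
        fun w => w - v := by
    ext w
    simp only [Finset.mem_filter, Finset.mem_insert, Finset.mem_image, ballPattern, reroot,
      Finset.mem_erase, h0v]
    constructor
    · rintro ⟨hw, hQ⟩
      rcases hw with rfl | ⟨⟨hw0, z, hz, rfl⟩, hwr⟩
      · exact ⟨v, Or.inr ⟨hv, hPv⟩, sub_self v⟩
      · refine ⟨z, hz.imp id fun hzS => ⟨hzS, fun i => ?_⟩, rfl⟩
        rw [← hPv i, ← hshift z i]
        exact hQ i
    · rintro ⟨z, hz, rfl⟩
      have hPz : ∀ i : Fin 3, ⌊(z i - u i) / s⌋ = ⌊(0 - u i) / s⌋ := by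
        rcases hz with rfl | ⟨-, hPz⟩
        · intro i; rw [PiLp.zero_apply]
        · exact hPz
      have hzv : ∀ i : Fin 3, ⌊(z i - u i) / s⌋ = ⌊(v i - u i) / s⌋ := fun i => by
        rw [hPz i, hPv i]
      refine ⟨?_, fun i => by rw [hshift]; exact hzv i⟩
      by_cases hzv0 : z - v = 0
      · exact Or.inl hzv0
      · exact Or.inr ⟨⟨hzv0, z, hz.imp id And.left, rfl⟩,
          (cubeTransport_norm_sub_lt hs u hzv).le.trans hsr⟩
  rw [key, Finset.card_image_of_injective _ sub_left_injective, Finset.card_insert_of_notMem]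
  exact fun h => h0 (Finset.mem_filter.1 h).1


/-- **Stub D (the cube transport, pointwise in the offset).** Fix a side `s > 0`, a range `r ≥ 2s`, a
level `L ≥ r + 2s`, an offset `u` and any site functional `χ (pattern, offset)`. For the rule
"`v` receives `χ` (read at `v`, offset seen from `v`) divided by the number of points in the root's cube,
provided `v` lies in the root's cube of the partition `sℤ³ + u`", the level-`(r, L)` transport
(out minus in, the in-term read with the offset `u − v` seen from `v`) of a `(δ, L)`-admissible pattern
equals the cube average of `χ` minus `χ` at the root: both endpoints of a same-cube pair count the same
cube (`same cube ⇒ distance < 2s ≤ r`, and `≤ L − r`, so every cube point is in the lens and in both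
`r`-balls). [folklore] -/
theorem stub_cubeTransport :
    ∀ (s r L δ : ℝ), 0 < s → 2 * s ≤ r → r + 2 * s ≤ L → 0 < δ →
      ∀ (χ : Finset (EuclideanSpace ℝ (Fin 3)) → (Fin 3 → ℝ) → ℝ)
        (G : EuclideanSpace ℝ (Fin 3) → Finset (EuclideanSpace ℝ (Fin 3)) → Finset (EuclideanSpace ℝ (Fin 3)) → (Fin 3 → ℝ) → ℝ),
        (∀ v p q u, G v p q u =
          if (∀ i : Fin 3, ⌊(v i - u i) / s⌋ = ⌊(0 - u i) / s⌋) then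
            χ q (fun i => u i - v i) /
              (((insert (0 : EuclideanSpace ℝ (Fin 3)) p).filter
                (fun w => ∀ i : Fin 3, ⌊(w i - u i) / s⌋ = ⌊(0 - u i) / s⌋)).card : ℝ)
          else 0) →
        ∀ (u : Fin 3 → ℝ) (S : Finset (EuclideanSpace ℝ (Fin 3))),
          Literature.Probability.PointProcesses.IsRootedPattern δ L S →
          ∑ v ∈ Literature.Probability.PointProcesses.lens r L S,
              (G v (Literature.Probability.PointProcesses.ballPattern r S)
                  (Literature.Probability.PointProcesses.ballPattern r (Literature.Probability.PointProcesses.reroot S v)) u -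
                G (-v) (Literature.Probability.PointProcesses.ballPattern r (Literature.Probability.PointProcesses.reroot S v))
                  (Literature.Probability.PointProcesses.ballPattern r S) (fun i => u i - v i)) =
            ((((insert (0 : EuclideanSpace ℝ (Fin 3)) (Literature.Probability.PointProcesses.ballPattern r S)).filter
                (fun w => ∀ i : Fin 3, ⌊(w i - u i) / s⌋ = ⌊(0 - u i) / s⌋)).card : ℝ))⁻¹ *
              ∑ w ∈ (insert (0 : EuclideanSpace ℝ (Fin 3)) (Literature.Probability.PointProcesses.ballPattern r S)).filter
                  (fun w => ∀ i : Fin 3, ⌊(w i - u i) / s⌋ = ⌊(0 - u i) / s⌋),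
                χ (Literature.Probability.PointProcesses.ballPattern r (Literature.Probability.PointProcesses.reroot S w))
                  (fun i => u i - w i) -
            χ (Literature.Probability.PointProcesses.ballPattern r S) u := by
  intro s r L δ hs hsr hrL hδ χ G hG u S hS
  have h0 : (0 : EuclideanSpace ℝ (Fin 3)) ∉ S := cubeTransport_zero_notMem hδ hS
  have hnot : (0 : EuclideanSpace ℝ (Fin 3)) ∉
      S.filter (fun w => ∀ i : Fin 3, ⌊(w i - u i) / s⌋ = ⌊(0 - u i) / s⌋) :=
    fun h => h0 (Finset.mem_filter.1 h).1
  have hsum : ∀ v ∈ lens r L S,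
      G v (ballPattern r S) (ballPattern r (reroot S v)) u -
        G (-v) (ballPattern r (reroot S v)) (ballPattern r S) (fun i => u i - v i) =
      if (∀ i : Fin 3, ⌊(v i - u i) / s⌋ = ⌊(0 - u i) / s⌋) then
        (χ (ballPattern r (reroot S v)) (fun i => u i - v i) - χ (ballPattern r S) u) /
          ((S.filter fun w => ∀ i : Fin 3, ⌊(w i - u i) / s⌋ = ⌊(0 - u i) / s⌋).card + 1 : ℝ)
      else 0 := by
    intro v hv
    have hvS : v ∈ S := (Finset.mem_filter.1 hv).1
    have hcond : (∀ i : Fin 3, ⌊((-v) i - (u i - v i)) / s⌋ = ⌊(0 - (u i - v i)) / s⌋) ↔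
        ∀ i : Fin 3, ⌊(v i - u i) / s⌋ = ⌊(0 - u i) / s⌋ := by
      refine forall_congr' fun i => ?_
      rw [PiLp.neg_apply, show -v i - (u i - v i) = 0 - u i by ring,
        show (0 : ℝ) - (u i - v i) = v i - u i by ring, eq_comm]
    have harg : (fun i => u i - v i - (-v) i) = u := funext fun i => by
      rw [PiLp.neg_apply]; ring
    simp only [hG]
    by_cases hP : ∀ i : Fin 3, ⌊(v i - u i) / s⌋ = ⌊(0 - u i) / s⌋
    · rw [if_pos hP, if_pos (hcond.2 hP), if_pos hP, harg,
        cubeTransport_card_reroot hs hsr u h0 hvS hP, cubeTransport_filter_insert_ball hs hsr u S,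
        Finset.card_insert_of_notMem hnot]
      push_cast
      ring
    · rw [if_neg hP, if_neg (mt hcond.1 hP), if_neg hP, sub_zero]
  rw [Finset.sum_congr rfl hsum, ← Finset.sum_filter, cubeTransport_filter_lens hs hrL u S,
    cubeTransport_filter_insert_ball hs hsr u S, Finset.sum_insert hnot,
    Finset.card_insert_of_notMem hnot, cubeTransport_reroot_zero h0]
  have hu0 : (fun i => u i - (0 : EuclideanSpace ℝ (Fin 3)) i) = u := funext fun i => by
    rw [PiLp.zero_apply, sub_zero]
  rw [hu0, ← Finset.sum_div, Finset.sum_sub_distrib, Finset.sum_const, nsmul_eq_mul]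
  push_cast
  have hN : ((S.filter fun w => ∀ i : Fin 3, ⌊(w i - u i) / s⌋ = ⌊(0 - u i) / s⌋).card : ℝ) +
      1 ≠ 0 := by
    positivity
  field_simp
  ring

end Summit.AtomisticToContinuum.Crystallization.Theorems.PatternPricedCertificates

end
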